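import Summits.KontsevichZagierPeriods.KontsevichZagierPeriods.Theses.GaussManinCertificates
import Literature.ModelTheory.ExponentialFields.CylindricalDecompositionProofs
import Literature.NumberTheory.Transcendental.KZLogCalculusProofs
import Literature.NumberTheory.Transcendental.KZDominatedFamilyRelations
import Literature.NumberTheory.Transcendental.KZSemiCanonicalReductionProofs

/-!
# `KZStokes` (stmt-KontsevichZagierPeriods-3012), file 1/4: maximal chains, frontier points, flattening

Route `GaussManinCertificates`, crux `KZStokes` (band Newton–Leibniz generates Stokes's formula on every
bounded `ℚ`-semialgebraic domain).  This is the first of the four files into which the crux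
strategist's complete, sorry-free proof `Cruxes/KZStokes/Lines/KZStokesProof.lean` is re-homed under
`Theorems/` (lead c10 of crux stmt-KontsevichZagierPeriods-9129, banking programme; the proof text is
the strategist's, verbatim up to the file split):

1. this file — `exists_maximal_chains` (ℕ-combinatorics of maximal chains band–section–band), the
   real-line frontier lemmas `mem_frontier_left/right_of_Ioo_subset`, `isSemialgebraic_openBand`, and
   the flattening lemma `assembleRuns` (run families over the cells of a finite partition combine;
   moved here from file 2 of the strategist's plan only to keep every file under 400 lines);
2. `Theorems/GaussManinCertificatesFibreRuns.lean` — `cellRuns` and `semialgebraicFibreRuns`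
   (registered stub `stub_semialgebraicFibreRuns`);
3. `Theorems/GaussManinCertificatesKZStokesBand.lean` — `kzStokesBand` (registered stub
   `stub_kzStokesBand`);
4. `Theorems/GaussManinCertificatesKZStokesSplit.lean` — the glue `KZStokes_of_subs` and the closing
   theorem `KZStokes_proof`.

No named fact is assumed; no new definition; axioms `propext`, `Classical.choice`, `Quot.sound` only.
References: Kontsevich–Zagier 2001, §1.2 (rules 1) and 3)); Basu–Pollack–Roy 2006, Thm. 5.6 /
Cor. 5.7.
-/

noncomputable section

open MeasureTheory Set Filter Topology
open Literature.ModelTheory.ExponentialFields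
open Literature.NumberTheory.Transcendental

namespace Summit.KontsevichZagierPeriods.GaussManinCertificates

/-! ### Maximal chains (combinatorics on `ℕ`) -/

/-- **Maximal chains.** For predicates `P` (bands) and `Q` (sections) on `ℕ` with `P k → 0 < k < L`,
linking `k` to `k + 1` when `P k ∧ Q k ∧ P (k + 1)`: there are finitely many index intervals
`(p_j, q_j]` (`p_j < q_j < L`) such that `P` holds on `(p_j, q_j]`, `Q` holds on `(p_j, q_j)`, the
chain cannot be extended below (`¬ (P p_j ∧ Q p_j)`) nor above (`¬ (Q q_j ∧ P (q_j + 1))`), every `k`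
with `P k` lies in some `(p_j, q_j]`, and distinct intervals are disjoint. [folklore] -/
theorem exists_maximal_chains (L : ℕ) (P Q : ℕ → Prop) (hP : ∀ k, P k → 0 < k ∧ k < L) :
    ∃ (J : ℕ) (p q : Fin J → ℕ),
      (∀ j, p j < q j) ∧ (∀ j, q j < L) ∧
      (∀ j k, p j < k → k ≤ q j → P k) ∧
      (∀ j k, p j < k → k < q j → Q k) ∧
      (∀ j, ¬ (P (p j) ∧ Q (p j))) ∧
      (∀ j, ¬ (Q (q j) ∧ P (q j + 1))) ∧
      (∀ k, P k → ∃ j, p j < k ∧ k ≤ q j) ∧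
      (∀ i j, i ≠ j → q i ≤ p j ∨ q j ≤ p i) := by
  classical
  -- `lk k`: the bands `k` and `k + 1` merge through the section `k`
  let lk : ℕ → Prop := fun k => P k ∧ Q k ∧ P (k + 1)
  have hstop : ∀ k, ∃ m, ¬ lk (k + m) := fun k =>
    ⟨L, fun h => by have := (hP _ h.2.2).2; omega⟩
  -- the end of the chain starting at `k`
  let e : ℕ → ℕ := fun k => k + Nat.find (hstop k)
  have he_not : ∀ k, ¬ lk (e k) := fun k => Nat.find_spec (hstop k)
  have he_lk : ∀ k m, k ≤ m → m < e k → lk m := by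
    intro k m hkm hme
    have hlt : m - k < Nat.find (hstop k) := by
      have : m < k + Nat.find (hstop k) := hme
      omega
    have h := Nat.find_min (hstop k) hlt
    rw [not_not] at h
    rwa [show k + (m - k) = m by omega] at h
  have he_ge : ∀ k, k ≤ e k := fun k => Nat.le_add_right _ _
  have hP_chain : ∀ k, P k → ∀ m, k ≤ m → m ≤ e k → P m := by
    intro k hk m hkm hme
    obtain ⟨d, rfl⟩ := Nat.exists_eq_add_of_le hkm
    induction d with
    | zero => simpa using hk
    | succ d ih =>
      have h1 : k + d < e k := by omega
      exact (he_lk k (k + d) (by omega) h1).2.2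
  have he_of_chain : ∀ s k, s ≤ k → (∀ m, s ≤ m → m < k → lk m) → k ≤ e s := by
    intro s k _ hch
    by_contra h
    exact he_not s (hch (e s) (he_ge s) (not_le.mp h))
  -- the starts of the chains
  let St : Finset ℕ := (Finset.range L).filter fun k => P k ∧ ¬ (P (k - 1) ∧ Q (k - 1))
  have hSt : ∀ k, k ∈ St ↔ k < L ∧ (P k ∧ ¬ (P (k - 1) ∧ Q (k - 1))) := fun k => by
    simp only [St, Finset.mem_filter, Finset.mem_range]
  -- every band of `P` lies in the chain of a start
  have hcover : ∀ k, P k → ∃ s ∈ St, s ≤ k ∧ ∀ m, s ≤ m → m < k → lk m := by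
    intro k
    refine Nat.strong_induction_on k ?_
    intro k ih hk
    by_cases hst : P (k - 1) ∧ Q (k - 1)
    · have hk1 : k - 1 < k := by have := (hP k hk).1; omega
      obtain ⟨s, hs, hsk, hch⟩ := ih (k - 1) hk1 hst.1
      refine ⟨s, hs, by omega, fun m hsm hmk => ?_⟩
      by_cases hm : m < k - 1
      · exact hch m hsm hm
      · have hm' : m = k - 1 := by omega
        subst hm'
        refine ⟨hst.1, hst.2, ?_⟩
        rw [show k - 1 + 1 = k by omega]
        exact hk
    · exact ⟨k, (hSt k).2 ⟨(hP k hk).2, hk, hst⟩, le_rfl, fun m hkm hmk => by omega⟩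
  -- enumerate the starts
  let st : Fin St.card → ℕ := fun j => (St.equivFin.symm j : ℕ)
  have hst_mem : ∀ j, st j ∈ St := fun j => (St.equivFin.symm j).2
  have hst_inj : Function.Injective st := fun i j h =>
    St.equivFin.symm.injective (Subtype.ext h)
  have hstP : ∀ j, P (st j) := fun j => ((hSt _).1 (hst_mem j)).2.1
  have hst1 : ∀ j, 1 ≤ st j := fun j => (hP _ (hstP j)).1
  refine ⟨St.card, fun j => st j - 1, fun j => e (st j), fun j => ?_, fun j => ?_, fun j k hpk hkq => ?_,
    fun j k hpk hkq => ?_, fun j => ((hSt _).1 (hst_mem j)).2.2, fun j h => ?_, fun k hk => ?_,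
    fun i j hij => ?_⟩
  · dsimp only
    have := hst1 j
    have := he_ge (st j)
    omega
  · exact (hP _ (hP_chain _ (hstP j) _ (he_ge _) le_rfl)).2
  · dsimp only at hpk hkq
    exact hP_chain _ (hstP j) k (by have := hst1 j; omega) hkq
  · dsimp only at hpk hkq
    exact (he_lk (st j) k (by have := hst1 j; omega) hkq).2.1
  · exact he_not (st j) ⟨hP_chain _ (hstP j) _ (he_ge _) le_rfl, h.1, h.2⟩
  · obtain ⟨s, hs, hsk, hch⟩ := hcover k hk
    have hsts : st (St.equivFin ⟨s, hs⟩) = s := by simp [st]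
    refine ⟨St.equivFin ⟨s, hs⟩, ?_, ?_⟩
    · dsimp only
      rw [hsts]
      have := (hP s ((hSt s).1 hs).2.1).1
      omega
    · dsimp only
      rw [hsts]
      exact he_of_chain s k hsk hch
  · dsimp only
    have hne : st i ≠ st j := fun h => hij (hst_inj h)
    have key : ∀ i j, st i < st j → e (st i) ≤ st j - 1 := by
      intro i j hlt
      have hj := (hSt _).1 (hst_mem j)
      by_contra h
      have hl := he_lk (st i) (st j - 1) (by omega) (not_le.mp h)
      exact hj.2.2 ⟨hl.1, hl.2.1⟩
    rcases lt_or_gt_of_ne hne with h | h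
    · exact Or.inl (key i j h)
    · exact Or.inr (key j i h)

/-! ### Frontier points on the real line -/

/-- The left end point `c` of an open interval `(c, d) ⊆ s` is a frontier point of `s` as soon as
`c ∉ s` or some interval `(c', c)` misses `s`. [folklore] -/
theorem mem_frontier_left_of_Ioo_subset {s : Set ℝ} {c d : ℝ} (hcd : c < d) (hsub : Ioo c d ⊆ s)
    (h : c ∉ s ∨ ∃ c', c' < c ∧ Ioo c' c ⊆ sᶜ) : c ∈ frontier s := by
  rw [frontier_eq_closure_inter_closure]
  refine ⟨closure_mono hsub ?_, ?_⟩
  · rw [closure_Ioo hcd.ne]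
    exact left_mem_Icc.2 hcd.le
  · rcases h with h | ⟨c', hc', hsub'⟩
    · exact subset_closure h
    · refine closure_mono hsub' ?_
      rw [closure_Ioo hc'.ne]
      exact right_mem_Icc.2 hc'.le

/-- The right end point `d` of an open interval `(c, d) ⊆ s` is a frontier point of `s` as soon as
`d ∉ s` or some interval `(d, d')` misses `s`. [folklore] -/
theorem mem_frontier_right_of_Ioo_subset {s : Set ℝ} {c d : ℝ} (hcd : c < d) (hsub : Ioo c d ⊆ s)
    (h : d ∉ s ∨ ∃ d', d < d' ∧ Ioo d d' ⊆ sᶜ) : d ∈ frontier s := by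
  rw [frontier_eq_closure_inter_closure]
  refine ⟨closure_mono hsub ?_, ?_⟩
  · rw [closure_Ioo hcd.ne]
    exact right_mem_Icc.2 hcd.le
  · rcases h with h | ⟨d', hd', hsub'⟩
    · exact subset_closure h
    · refine closure_mono hsub' ?_
      rw [closure_Ioo hd'.ne]
      exact left_mem_Icc.2 hd'.le

/-- An open band `{(x, t) | x ∈ S, a x < t < b x}` with `ℚ`-semialgebraic edges over `S` is
`ℚ`-semialgebraic (closed band minus the two edge graphs). [folklore] -/
theorem isSemialgebraic_openBand {n : ℕ} {S : Set (Fin n → ℝ)} {a b : (Fin n → ℝ) → ℝ}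
    (ha : IsSemialgebraicFunOn ℚ S a) (hb : IsSemialgebraicFunOn ℚ S b) :
    IsSemialgebraic ℚ {z : Fin (n + 1) → ℝ | Fin.init z ∈ S ∧
      z (Fin.last n) ∈ Ioo (a (Fin.init z)) (b (Fin.init z))} := by
  have h1 := KZlog.isSemialgebraic_band ha hb
  have h2 : IsSemialgebraic ℚ (graphOver S a) :=
    isSemialgebraicFunOn_iff_isSemialgebraic_graphOver.1 ha
  have h3 : IsSemialgebraic ℚ (graphOver S b) :=
    isSemialgebraicFunOn_iff_isSemialgebraic_graphOver.1 hb
  convert h1.diff (h2.union h3) using 1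
  ext z
  simp only [mem_setOf_eq, mem_Ioo, KZlog.mem_band, Set.mem_sdiff, mem_union, mem_graphOver_iff]
  constructor
  · rintro ⟨hS', h1, h2⟩
    exact ⟨⟨hS', h1.le, h2.le⟩, fun h => h.elim (fun h => h1.ne' h.2) fun h => h2.ne h.2⟩
  · rintro ⟨⟨hS', h1, h2⟩, h⟩
    obtain ⟨ha', hb'⟩ := not_or.mp h
    exact ⟨hS', lt_of_le_of_ne h1 fun e => ha' ⟨hS', e.symm⟩, lt_of_le_of_ne h2 fun e => hb' ⟨hS', e⟩⟩

/-! ### Flattening over the cells -/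

/-- **Flattening** (registered stub `stub_assembleRuns` of the birth skeleton of piece
`SemialgebraicFibreRuns`, verbatim): run families over the cells of a finite partition of `ℝⁿ` into
`ℚ`-semialgebraic sets combine into one run family for `σ` (disjoint cells have disjoint cylinders; the
remainders add up to a null set). [folklore] -/
theorem assembleRuns :
    ∀ (n : ℕ) (σ : Set (Fin (n + 1) → ℝ)) (𝒮 : Finset (Set (Fin n → ℝ))),
      Setoid.IsPartition (𝒮 : Set (Set (Fin n → ℝ))) →
      (∀ S ∈ 𝒮, Literature.ModelTheory.ExponentialFields.IsSemialgebraic ℚ S) →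
      (∀ S ∈ 𝒮, ∃ (J : ℕ) (a b : Fin J → (Fin n → ℝ) → ℝ) (R : Fin J → Set (Fin (n + 1) → ℝ)),
        (∀ j, Literature.NumberTheory.Transcendental.IsSemialgebraicFunOn ℚ S (a j)) ∧
        (∀ j, Literature.NumberTheory.Transcendental.IsSemialgebraicFunOn ℚ S (b j)) ∧
        (∀ j, ∀ x ∈ S, a j x < b j x) ∧
        (∀ j, R j = {z : Fin (n + 1) → ℝ | Fin.init z ∈ S ∧
          z (Fin.last n) ∈ Set.Ioo (a j (Fin.init z)) (b j (Fin.init z))}) ∧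
        (∀ j, Literature.ModelTheory.ExponentialFields.IsSemialgebraic ℚ (R j)) ∧
        (∀ j, ∀ x ∈ S, Set.Ioo (a j x) (b j x) ⊆ {s : ℝ | (Fin.snoc x s : Fin (n + 1) → ℝ) ∈ σ}) ∧
        (∀ j, ∀ x ∈ S, a j x ∈ frontier {s : ℝ | (Fin.snoc x s : Fin (n + 1) → ℝ) ∈ σ} ∧
          b j x ∈ frontier {s : ℝ | (Fin.snoc x s : Fin (n + 1) → ℝ) ∈ σ}) ∧
        (Pairwise fun i j => Disjoint (R i) (R j)) ∧
        MeasureTheory.volume ((σ ∩ {z : Fin (n + 1) → ℝ | Fin.init z ∈ S}) \ ⋃ j, R j) = 0) →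
      ∃ (J : ℕ) (S : Fin J → Set (Fin n → ℝ)) (a b : Fin J → (Fin n → ℝ) → ℝ) (R : Fin J → Set (Fin (n + 1) → ℝ)),
        (∀ j, Literature.ModelTheory.ExponentialFields.IsSemialgebraic ℚ (S j)) ∧
        (∀ j, Literature.NumberTheory.Transcendental.IsSemialgebraicFunOn ℚ (S j) (a j)) ∧
        (∀ j, Literature.NumberTheory.Transcendental.IsSemialgebraicFunOn ℚ (S j) (b j)) ∧
        (∀ j, ∀ x ∈ S j, a j x < b j x) ∧
        (∀ j, R j = {z : Fin (n + 1) → ℝ | Fin.init z ∈ S j ∧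
          z (Fin.last n) ∈ Set.Ioo (a j (Fin.init z)) (b j (Fin.init z))}) ∧
        (∀ j, Literature.ModelTheory.ExponentialFields.IsSemialgebraic ℚ (R j)) ∧
        (∀ j, ∀ x ∈ S j, Set.Ioo (a j x) (b j x) ⊆ {s : ℝ | (Fin.snoc x s : Fin (n + 1) → ℝ) ∈ σ}) ∧
        (∀ j, ∀ x ∈ S j, a j x ∈ frontier {s : ℝ | (Fin.snoc x s : Fin (n + 1) → ℝ) ∈ σ} ∧
          b j x ∈ frontier {s : ℝ | (Fin.snoc x s : Fin (n + 1) → ℝ) ∈ σ}) ∧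
        (Pairwise fun i j => Disjoint (R i) (R j)) ∧
        MeasureTheory.volume (σ \ ⋃ j, R j) = 0 := by
  classical
  intro n σ 𝒮 hpart hsa hcell
  choose J a b R hA hB hab hR hRsa hIoo hfr hdisj hnull using hcell
  -- one index type for all the runs
  let ι := Σ s : {S // S ∈ 𝒮}, Fin (J s.1 s.2)
  let F : ι → Set (Fin (n + 1) → ℝ) := fun u => R u.1.1 u.1.2 u.2
  let e : Fin (Fintype.card ι) ≃ ι := (Fintype.equivFin ι).symm
  -- runs with distinct indices are disjoint
  have hcyl : ∀ u : ι, F u ⊆ {z : Fin (n + 1) → ℝ | Fin.init z ∈ (u.1 : Set (Fin n → ℝ))} := by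
    rintro ⟨⟨S, hS⟩, k⟩ z hz
    simp only [F] at hz
    rw [hR S hS k] at hz
    exact hz.1
  have key : ∀ u v : ι, u ≠ v → Disjoint (F u) (F v) := by
    rintro ⟨⟨S, hS⟩, k⟩ ⟨⟨S', hS'⟩, k'⟩ huv
    by_cases hSS' : S = S'
    · subst hSS'
      have hkk' : k ≠ k' := fun h => huv (by subst h; rfl)
      exact hdisj S hS hkk'
    · have hcells : Disjoint S S' :=
        hpart.pairwiseDisjoint (Finset.mem_coe.2 hS) (Finset.mem_coe.2 hS') hSS'
      rw [Set.disjoint_left]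
      intro z hz hz'
      have h1 := hcyl _ hz
      have h2 := hcyl _ hz'
      simp only [mem_setOf_eq] at h1 h2
      exact Set.disjoint_left.1 hcells h1 h2
  refine ⟨Fintype.card ι, fun i => (e i).1.1, fun i => a _ (e i).1.2 (e i).2,
    fun i => b _ (e i).1.2 (e i).2, fun i => F (e i), fun i => hsa _ (e i).1.2,
    fun i => hA _ (e i).1.2 (e i).2, fun i => hB _ (e i).1.2 (e i).2, fun i => hab _ (e i).1.2 (e i).2,
    fun i => hR _ (e i).1.2 (e i).2, fun i => hRsa _ (e i).1.2 (e i).2,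
    fun i => hIoo _ (e i).1.2 (e i).2, fun i => hfr _ (e i).1.2 (e i).2,
    fun i j hij => key _ _ fun h => hij (e.injective h), ?_⟩
  -- the remainder is the union of the remainders over the cells
  have hU : (⋃ i, F (e i)) = ⋃ u, F u := e.surjective.iUnion_comp F
  have hrem : σ \ (⋃ u, F u) ⊆ ⋃ s : {S // S ∈ 𝒮},
      ((σ ∩ {z : Fin (n + 1) → ℝ | Fin.init z ∈ (s.1 : Set (Fin n → ℝ))}) \ ⋃ k, R s.1 s.2 k) := by
    rintro z ⟨hzσ, hz⟩
    have hcov : (Fin.init z : Fin n → ℝ) ∈ ⋃₀ (𝒮 : Set (Set (Fin n → ℝ))) := by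
      rw [hpart.sUnion_eq_univ]
      exact mem_univ _
    obtain ⟨S, hS, hzS⟩ := mem_sUnion.1 hcov
    refine mem_iUnion.2 ⟨⟨S, Finset.mem_coe.1 hS⟩, ⟨hzσ, hzS⟩, fun hz' => hz ?_⟩
    obtain ⟨k, hk⟩ := mem_iUnion.1 hz'
    exact mem_iUnion.2 ⟨⟨⟨S, Finset.mem_coe.1 hS⟩, k⟩, hk⟩
  show volume (σ \ ⋃ i, F (e i)) = 0
  rw [hU]
  exact measure_mono_null hrem (measure_iUnion_null_iff.2 fun s => hnull s.1 s.2)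

end Summit.KontsevichZagierPeriods.GaussManinCertificates
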